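import Mathlib.Analysis.SpecialFunctions.SmoothTransition
import Literature.Topology.FourManifolds.DiffeotopyTransport
import HarnessLib

/-!
# The unit-ball and the radius-free forms of "`π₀` of the compactly supported diffeomorphisms is trivial" agree

Topic `Literature/Topology/FourManifolds`; pure-proof companion of `DiffeotopyTransport.lean`.
That file defines the two predicates on a real normed space `E`

* `Literature.Topology.FourManifolds.CompactDiffeotopyTrivial E`: every diffeomorphism of `E`
  equal to the identity off some ball `B̄(0, R)` is the time-one stage of a diffeotopy of `E` all of
  whose stages are the identity off some (possibly larger) ball;
* `Literature.Topology.FourManifolds.UnitBallDiffeotopyTrivial E`: the same with all supports in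
  the closed unit ball (for `E = ℝ³` this is Cerf's `π₀(Diff(D³; S²)) = 0`, the named fact
  `cerf_pi0DiffDisc_relBoundary_three` of `CerfPropositionFour.lean`),

and proves `CompactDiffeotopyTrivial.of_unitBall : UnitBallDiffeotopyTrivial E → CompactDiffeotopyTrivial E`
(conjugation by homotheties). Here we prove the converse
`Literature.Topology.FourManifolds.UnitBallDiffeotopyTrivial.of_compact`, whence the equivalence
`Literature.Topology.FourManifolds.compactDiffeotopyTrivial_iff_unitBall`: the normalisation of
the supports of the *diffeotopy* to the unit ball costs nothing.

## The argument

Let `s` be supported in `B̄(0, 1)` and let `D` be a diffeotopy from the identity to `s` supported in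
`B̄(0, R')`; put `R = max(R', 1)` and `c = R⁻¹ ∈ (0, 1]`. Conjugating `D` by the homothety of ratio
`c` (`Diffeotopy.pushforward`) gives a diffeotopy supported in `B̄(0, 1)` from the identity to the
*shrunken* diffeomorphism `sᶜ = c • s (c⁻¹ • ·)`, supported in `B̄(0, c)`. It remains to join `sᶜ`
to `s` inside the unit ball: the conjugates `s^{γ}` of `s` by the homotheties of ratio
`γ ∈ [c, 1]` are all supported in `B̄(0, 1)`, so letting the ratio run smoothly from `c` to `1`
(`γ(t) = c + (1 - c) χ(t)`, `χ` Mathlib's `Real.smoothTransition`, so that `γ` is constant off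
`[0, 1]` and the family is defined for all real times) the family `K_t = s^{γ(t)} ∘ (sᶜ)⁻¹` is a
diffeotopy supported in `B̄(0, 1)` from the identity to `s ∘ (sᶜ)⁻¹`
(`exists_diffeotopy_homothetyConj`); the stagewise composite (`Diffeotopy.trans`) of the shrunken
`D` with `K` is supported in `B̄(0, 1)` and ends at `s ∘ (sᶜ)⁻¹ ∘ sᶜ = s`. This is the standard
"Alexander-type rescaling inside the group of compactly supported diffeomorphisms" (e.g. the proof
that the inclusion `Diff_∂(Dⁿ(r)) ↪ Diff_∂(Dⁿ(1))`, `r ≤ 1`, is a homotopy equivalence); no source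
states it in exactly this form, hence `[folklore]`.

## References

* M. W. Hirsch, *Differential Topology*, GTM 33, Springer (1976), Ch. 8 §1 (diffeotopies and
  their supports). [HirschDT1976]
* J. Cerf, *Sur les difféomorphismes de la sphère de dimension trois (Γ₄ = 0)*, LNM 53 (1968),
  Ch. I §2, (2) and Appendice §5 (the group `𝒦`). [CerfDiffeoSphere1968]
-/

open scoped Manifold ContDiff Topology
open Function Set

noncomputable section

namespace Literature.Topology.FourManifolds

variable {E : Type*} [NormedAddCommGroup E] [NormedSpace ℝ E]

/-- For `0 < a ≤ 1` and `1 ≤ ‖y‖` one has `1 ≤ ‖a⁻¹ • y‖`. [folklore] -/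
theorem one_le_norm_inv_smul {a : ℝ} (ha : 0 < a) (ha1 : a ≤ 1) {y : E} (hy : 1 ≤ ‖y‖) :
    1 ≤ ‖a⁻¹ • y‖ := by
  rw [norm_smul, norm_inv, Real.norm_of_nonneg ha.le]
  exact one_le_mul_of_one_le_of_one_le ((one_le_inv₀ ha).2 ha1) hy

/-- **The rescaling diffeotopy.** Let `s` be a diffeomorphism of `E` equal to the identity on
`{‖y‖ ≥ 1}` and `0 < c ≤ 1`; write `s^{a} = a • s (a⁻¹ • ·)` for the conjugate of `s` by the
homothety of ratio `a` (supported in `B̄(0, a)`). Then there is a diffeotopy `K` of `E`, all of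
whose stages are the identity on `{‖y‖ ≥ 1}`, with `K₁ = s ∘ (sᶜ)⁻¹`, namely
`K_t = s^{γ(t)} ∘ (sᶜ)⁻¹` with `γ(t) = c + (1 - c) χ(t)`, `χ` the smooth transition function
(`γ(0) = c`, `γ(1) = 1`, `c ≤ γ ≤ 1`). [folklore] -/
theorem exists_diffeotopy_homothetyConj (s : E ≃ₘ⟮𝓘(ℝ, E), 𝓘(ℝ, E)⟯ E)
    (hs : ∀ y, 1 ≤ ‖y‖ → s y = y) {c : ℝ} (hc : 0 < c) (hc1 : c ≤ 1) :
    ∃ K : Diffeotopy 𝓘(ℝ, E) E,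
      (∀ y, K.toFun 1 y = s (c • s.symm (c⁻¹ • y))) ∧ ∀ t y, 1 ≤ ‖y‖ → K.toFun t y = y := by
  have hs' : ∀ y, 1 ≤ ‖y‖ → s.symm y = y := fun y hy => by
    conv_lhs => rw [← hs y hy]
    exact s.symm_apply_apply y
  have hc0 : c ≠ 0 := hc.ne'
  -- the ratio `γ t ∈ [c, 1]`
  obtain ⟨γ, hγ⟩ : ∃ γ : ℝ → ℝ, γ = fun t => c + (1 - c) * Real.smoothTransition t := ⟨_, rfl⟩
  have hγc : ∀ t, c ≤ γ t := fun t => by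
    have h1 : 0 ≤ (1 - c) * Real.smoothTransition t :=
      mul_nonneg (sub_nonneg.2 hc1) (Real.smoothTransition.nonneg t)
    rw [hγ]; linarith
  have hγ1 : ∀ t, γ t ≤ 1 := fun t => by
    have h1 : (1 - c) * Real.smoothTransition t ≤ 1 - c :=
      mul_le_of_le_one_right (sub_nonneg.2 hc1) (Real.smoothTransition.le_one t)
    rw [hγ]; linarith
  have hγpos : ∀ t, 0 < γ t := fun t => hc.trans_le (hγc t)
  have hγne : ∀ t, γ t ≠ 0 := fun t => (hγpos t).ne'
  have hγ0 : γ 0 = c := by simp [hγ, Real.smoothTransition.zero]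
  have hγone : γ 1 = 1 := by simp [hγ, Real.smoothTransition.one]
  have hγs : ContDiff ℝ ∞ γ := by
    rw [hγ]; exact contDiff_const.add (contDiff_const.mul Real.smoothTransition.contDiff)
  -- smoothness of the family `K_t = s^{γ t} ∘ (sᶜ)⁻¹` and of the inverse family `sᶜ ∘ (s^{γ t})⁻¹`
  have hsc : ContDiff ℝ ∞ (s : E → E) := contMDiff_iff_contDiff.mp s.contMDiff
  have hsc' : ContDiff ℝ ∞ (s.symm : E → E) := contMDiff_iff_contDiff.mp s.symm.contMDiff
  have hγp : ContDiff ℝ ∞ fun p : ℝ × E => γ p.1 := hγs.comp contDiff_fst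
  have hγp' : ContDiff ℝ ∞ fun p : ℝ × E => (γ p.1)⁻¹ := hγp.inv fun p => hγne p.1
  have hFs : ContDiff ℝ ∞
      (uncurry fun (t : ℝ) (y : E) => γ t • s ((γ t)⁻¹ • (c • s.symm (c⁻¹ • y)))) :=
    hγp.smul (hsc.comp (hγp'.smul ((hsc'.comp (contDiff_snd.const_smul c⁻¹)).const_smul c)))
  have hGs : ContDiff ℝ ∞
      (uncurry fun (t : ℝ) (y : E) => c • s (c⁻¹ • (γ t • s.symm ((γ t)⁻¹ • y)))) :=
    (hsc.comp ((hγp.smul (hsc'.comp (hγp'.smul contDiff_snd))).const_smul c⁻¹)).const_smul c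
  refine ⟨Diffeotopy.mk' 𝓘(ℝ, E)
      (fun t y => γ t • s ((γ t)⁻¹ • (c • s.symm (c⁻¹ • y))))
      (fun t y => c • s (c⁻¹ • (γ t • s.symm ((γ t)⁻¹ • y))))
      (contMDiff_prod_self_of_contDiff hFs) (contMDiff_prod_self_of_contDiff hGs)
      (fun t y => ?_) (fun t y => ?_) ?_, fun y => ?_, fun t y hy => ?_⟩
  · -- left inverse
    simp only [inv_smul_smul₀ (hγne t), Diffeomorph.symm_apply_apply, smul_inv_smul₀ (hγne t),
      inv_smul_smul₀ hc0, Diffeomorph.apply_symm_apply, smul_inv_smul₀ hc0]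
  · -- right inverse
    simp only [inv_smul_smul₀ hc0, Diffeomorph.symm_apply_apply, smul_inv_smul₀ hc0,
      inv_smul_smul₀ (hγne t), Diffeomorph.apply_symm_apply, smul_inv_smul₀ (hγne t)]
  · -- identity at time `0` (`γ 0 = c`)
    funext y
    simp only [hγ0, inv_smul_smul₀ hc0, Diffeomorph.apply_symm_apply, smul_inv_smul₀ hc0, id]
  · -- time `1` (`γ 1 = 1`)
    rw [Diffeotopy.mk'_toFun]
    simp only [hγone, inv_one, one_smul]
  · -- support
    rw [Diffeotopy.mk'_toFun]
    rw [hs' _ (one_le_norm_inv_smul hc hc1 hy), smul_inv_smul₀ hc0,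
      hs _ (one_le_norm_inv_smul (hγpos t) (hγ1 t) hy), smul_inv_smul₀ (hγne t)]

/-- **Radius-free form ⇒ unit-ball form**: if every compactly supported diffeomorphism of `E` is
compactly diffeotopic to the identity, then every diffeomorphism of `E` supported in the closed
unit ball is diffeotopic to the identity *through a diffeotopy supported in the closed unit ball*.
Shrink the given diffeotopy into the unit ball by a homothety of ratio `c = (max(R', 1))⁻¹`
(`Diffeotopy.pushforward`) — it then ends at the shrunken `sᶜ` — and compose stagewise
(`Diffeotopy.trans`) with the rescaling diffeotopy `exists_diffeotopy_homothetyConj` from the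
identity to `s ∘ (sᶜ)⁻¹`. Converse of `CompactDiffeotopyTrivial.of_unitBall`. [folklore] -/
theorem UnitBallDiffeotopyTrivial.of_compact (h : CompactDiffeotopyTrivial E) :
    UnitBallDiffeotopyTrivial E := by
  intro s hs
  obtain ⟨D, hD1, R', hD⟩ := h s 1 hs
  have hD1' : D.toFun 1 = s := by rw [← Diffeotopy.coe_stage, hD1]
  -- the radius `R = max(R', 1)` and the ratio `R⁻¹ ∈ (0, 1]`
  set R : ℝ := max R' 1 with hR
  have hR1 : 1 ≤ R := le_max_right _ _
  have hR0 : 0 < R := one_pos.trans_le hR1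
  have hc : 0 < R⁻¹ := inv_pos.2 hR0
  have hc1 : R⁻¹ ≤ 1 := inv_le_one_of_one_le₀ hR1
  obtain ⟨K, hK1, hK⟩ := exists_diffeotopy_homothetyConj s hs hc hc1
  refine ⟨(D.pushforward (homothetyDiffeomorph R⁻¹ hc.ne')).trans K, ?_, fun t y hy => ?_⟩
  · ext y
    simp only [Diffeotopy.coe_stage, Diffeotopy.trans_toFun, comp_apply,
      Diffeotopy.pushforward_toFun, homothetyDiffeomorph_apply, homothetyDiffeomorph_symm_apply,
      inv_inv, hK1, hD1', smul_inv_smul₀ hR0.ne', Diffeomorph.symm_apply_apply,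
      inv_smul_smul₀ hR0.ne']
  · have hy' : R' ≤ ‖R • y‖ := by
      rw [norm_smul, Real.norm_of_nonneg hR0.le]
      exact (le_max_left _ _).trans (le_mul_of_one_le_right hR0.le hy)
    simp only [Diffeotopy.trans_toFun, comp_apply, Diffeotopy.pushforward_toFun,
      homothetyDiffeomorph_apply, homothetyDiffeomorph_symm_apply, inv_inv, hD t _ hy',
      inv_smul_smul₀ hR0.ne']
    exact hK t y hy

/-- **The two normalisations agree**: `π₀` of the compactly supported diffeomorphisms of `E` is
trivial in the radius-free sense iff it is in the unit-ball sense (Cerf's group `𝒦` for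
`E = ℝⁿ`). [folklore] -/
theorem compactDiffeotopyTrivial_iff_unitBall :
    CompactDiffeotopyTrivial E ↔ UnitBallDiffeotopyTrivial E :=
  ⟨UnitBallDiffeotopyTrivial.of_compact, CompactDiffeotopyTrivial.of_unitBall⟩

end Literature.Topology.FourManifolds

end
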